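import Mathlib.Analysis.InnerProductSpace.Calculus
import Literature.Analysis.FluidPDE.SingularKernelGradient
import HarnessLib

/-!
# The Biot–Savart kernel is a `C¹` singular kernel of degree `−2`; the Biot–Savart velocity of a
# Hölder vorticity is `C¹`

Topic `Literature/Analysis/FluidPDE`. The intended inhabitant of the kernel class
`IsC1SingularKernel` of `SingularKernelTruncation.lean`: the Biot–Savart kernel
`K₃(z) h = (4π|z|³)⁻¹ h × z` of Majda–Bertozzi, *Vorticity and Incompressible Flow* (CUP 2002),
(2.94)–(2.95), bundled as an operator-valued map `biotSavartCLM : ℝ³ → (ℝ³ →L[ℝ] ℝ³)`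
(`biotSavartCLM z h = biotSavartKernel z h`), is `C^∞` off the origin and homogeneous of degree
`−2` ((4.30)), so its derivative is homogeneous of degree `−3` ((4.31); the tree's
`fderiv_homogeneous`, `NewtonKernel.lean`) and both are bounded by a constant times the right
power of `|z|` (compactness of the unit sphere). Consequently the `C¹`-regularity theorem
`contDiff_singularPotential` (`SingularKernelGradient.lean`; Gilbarg–Trudinger §4.1 Lemma 4.2)
applies to the Biot–Savart law: **the velocity `v = K₃ ∗ ω` of a compactly supported
`γ`-Hölder vorticity, `0 < γ`, is continuously differentiable**, with the gradient formula of
that file (the qualitative content of Majda–Bertozzi Prop. 2.20 / (4.49),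
"`∇v(x) = PV∫ P₃(x − y) ω(y) dy + c ω(x)`", and of (4.39), "`|K₃ f|_{1,γ} ≤ c‖f‖_γ`").

## Contents (all proved)

* `biotSavartCLM`, `biotSavartCLM_apply` (`= biotSavartKernel`), `biotSavartCLM_smul`
  (homogeneity of degree `−2`), `contDiffAt_biotSavartCLM` (smooth off `0`);
* `exists_isC1SingularKernel_biotSavartCLM` — `∃ A, IsC1SingularKernel biotSavartCLM A`;
* `singularPotential_biotSavartCLM` (`= biotSavart`), `contDiff_biotSavart`,
  `hasFDerivAt_biotSavart`.

## References

* A. J. Majda, A. L. Bertozzi, *Vorticity and Incompressible Flow* (CUP 2002), (2.94)–(2.95),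
  §2.4.3 Prop. 2.20, §4.1.3 (4.30)–(4.31), (4.39). [MajdaBertozziCUP2002]
* D. Gilbarg, N. S. Trudinger, *Elliptic PDE of Second Order* (2001), §4.1 Lemma 4.2.
  [GilbargTrudinger2001]
-/

noncomputable section

open MeasureTheory Set Function Filter Metric Real
open _root_.Topology
open scoped ENNReal NNReal

namespace Literature.Analysis.FluidPDE

/-- Local notation for physical space `ℝ³ = EuclideanSpace ℝ (Fin 3)`. -/
local notation "ℝ³" => EuclideanSpace ℝ (Fin 3)

/-! ### The Biot–Savart kernel as an operator-valued map -/

/-- **The Biot–Savart kernel bundled as a continuous linear map in the vorticity slot**: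
`biotSavartCLM z = (4π|z|³)⁻¹ • (h ↦ h × z)` (Majda–Bertozzi (2.95), the `3 × 3` matrix kernel
`K₃(x)`), built from the tree's bilinear `crossCLM`. [cite: MajdaBertozziCUP2002, §2.4.1 (2.95)] -/
def biotSavartCLM (z : ℝ³) : ℝ³ →L[ℝ] ℝ³ :=
  (4 * π * ‖z‖ ^ 3)⁻¹ • crossCLM.flip z

/-- `biotSavartCLM z h = biotSavartKernel z h`. [folklore] -/
@[simp]
theorem biotSavartCLM_apply (z h : ℝ³) : biotSavartCLM z h = biotSavartKernel z h := rfl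

/-- **Homogeneity of degree `−2`**: `K₃(c z) = c⁻² K₃(z)` for `c > 0` (Majda–Bertozzi (4.30)). [cite: MajdaBertozziCUP2002, §4.1.3 (4.30)] -/
theorem biotSavartCLM_smul (c : ℝ) (hc : 0 < c) (z : ℝ³) :
    biotSavartCLM (c • z) = c ^ (-2 : ℤ) • biotSavartCLM z := by
  rcases eq_or_ne z 0 with rfl | hz
  · ext h
    simp [biotSavartCLM]
  · rw [biotSavartCLM, biotSavartCLM, map_smul, smul_smul, smul_smul, norm_smul, Real.norm_eq_abs,
      abs_of_pos hc]
    congr 1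
    have hzn : ‖z‖ ≠ 0 := norm_ne_zero_iff.2 hz
    have hc0 : c ≠ 0 := hc.ne'
    rw [zpow_neg, zpow_ofNat]
    field_simp

/-- **`K₃` is smooth off the origin** (`z ↦ (4π|z|³)⁻¹` is smooth there and `z ↦ (· × z)` is
linear). [folklore] -/
theorem contDiffAt_biotSavartCLM {z : ℝ³} (hz : z ≠ 0) {n : WithTop ℕ∞} :
    ContDiffAt ℝ n biotSavartCLM z := by
  have h1 : ContDiffAt ℝ n (fun z : ℝ³ => (4 * π * ‖z‖ ^ 3)⁻¹) z := by
    refine ContDiffAt.inv ?_ (by positivity [norm_pos_iff.2 hz])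
    exact contDiffAt_const.mul ((contDiffAt_norm ℝ hz).pow 3)
  exact h1.smul (crossCLM.flip.contDiff.contDiffAt)

/-- The size bound `‖K₃(z)‖ ≤ (4π)⁻¹ (‖z‖²)⁻¹` in operator norm (`norm_biotSavartKernel_le`). [folklore] -/
theorem norm_biotSavartCLM_le (z : ℝ³) : ‖biotSavartCLM z‖ ≤ (4 * π)⁻¹ * (‖z‖ ^ 2)⁻¹ := by
  refine ContinuousLinearMap.opNorm_le_bound _ (by positivity) fun h => ?_
  rw [biotSavartCLM_apply]
  calc ‖biotSavartKernel z h‖ ≤ (4 * π)⁻¹ * ‖h‖ * (‖z‖ ^ 2)⁻¹ := norm_biotSavartKernel_le z h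
    _ = (4 * π)⁻¹ * (‖z‖ ^ 2)⁻¹ * ‖h‖ := by ring

/-- **The Biot–Savart kernel is a `C¹` singular kernel of degree `−2`** for some constant `A`:
`C¹` off the origin, `‖K₃(z)‖ ≤ A|z|⁻²`, `‖∇K₃(z)‖ ≤ A|z|⁻³` (the derivative is homogeneous of
degree `−3`, `fderiv_homogeneous`, and bounded on the unit sphere by compactness;
Majda–Bertozzi (4.30)–(4.31)). [cite: MajdaBertozziCUP2002, §4.1.3 (4.30)–(4.31)] -/
theorem exists_isC1SingularKernel_biotSavartCLM : ∃ A : ℝ, IsC1SingularKernel biotSavartCLM A := by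
  -- homogeneity of the derivative
  have hhom : ∀ c : ℝ, 0 < c → ∀ z : ℝ³, biotSavartCLM (c • z) = c ^ (-2 : ℤ) • biotSavartCLM z :=
    biotSavartCLM_smul
  have hD : ∀ c : ℝ, 0 < c → ∀ z : ℝ³,
      fderiv ℝ biotSavartCLM (c • z) = c ^ ((-2 : ℤ) - 1) • fderiv ℝ biotSavartCLM z :=
    fderiv_homogeneous biotSavartCLM (-2) hhom
  -- bound of the derivative on the unit sphere
  have hcont : ContinuousOn (fderiv ℝ biotSavartCLM) (sphere (0 : ℝ³) 1) := by
    intro u hu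
    have hu0 : u ≠ 0 := by
      intro h
      rw [h, mem_sphere_zero_iff_norm, norm_zero] at hu
      exact zero_ne_one hu
    exact ((contDiffAt_biotSavartCLM hu0 (n := 1)).continuousAt_fderiv one_ne_zero).continuousWithinAt
  obtain ⟨M, hM⟩ := (isCompact_sphere (0 : ℝ³) 1).exists_bound_of_continuousOn
    (f := fderiv ℝ biotSavartCLM) hcont
  refine ⟨max (4 * π)⁻¹ (max M 0), ?_, fun z => ?_, fun z hz => ?_⟩
  · exact fun z hz => contDiffAt_biotSavartCLM hz
  · exact (norm_biotSavartCLM_le z).trans (mul_le_mul_of_nonneg_right (le_max_left _ _) (by positivity))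
  · -- write `z = ‖z‖ • u` with `u` on the unit sphere
    have hzn : 0 < ‖z‖ := norm_pos_iff.2 hz
    set u : ℝ³ := ‖z‖⁻¹ • z with hu
    have hun : ‖u‖ = 1 := by
      rw [hu, norm_smul, norm_inv, norm_norm, inv_mul_cancel₀ hzn.ne']
    have hzu : z = ‖z‖ • u := by
      rw [hu, smul_smul, mul_inv_cancel₀ hzn.ne', one_smul]
    have h1 : fderiv ℝ biotSavartCLM z = ‖z‖ ^ ((-2 : ℤ) - 1) • fderiv ℝ biotSavartCLM u := by
      conv_lhs => rw [hzu]
      exact hD ‖z‖ hzn u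
    have hMu : ‖fderiv ℝ biotSavartCLM u‖ ≤ M := hM u (mem_sphere_zero_iff_norm.2 hun)
    have hM0 : M ≤ max (4 * π)⁻¹ (max M 0) := (le_max_left _ _).trans (le_max_right _ _)
    have hzpow : ‖z‖ ^ ((-2 : ℤ) - 1) = (‖z‖ ^ 3)⁻¹ := by
      rw [show ((-2 : ℤ) - 1) = -((3 : ℕ) : ℤ) by norm_num, zpow_neg, zpow_natCast]
    rw [h1, hzpow]
    refine ContinuousLinearMap.opNorm_le_bound _ (by positivity) fun e => ?_
    rw [smul_apply, norm_smul, Real.norm_eq_abs, abs_of_nonneg (by positivity)]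
    calc (‖z‖ ^ 3)⁻¹ * ‖fderiv ℝ biotSavartCLM u e‖
        ≤ (‖z‖ ^ 3)⁻¹ * (‖fderiv ℝ biotSavartCLM u‖ * ‖e‖) := by
          gcongr
          exact ContinuousLinearMap.le_opNorm _ _
      _ ≤ (‖z‖ ^ 3)⁻¹ * (max (4 * π)⁻¹ (max M 0) * ‖e‖) := by
          gcongr
          exact hMu.trans hM0
      _ = max (4 * π)⁻¹ (max M 0) * (‖z‖ ^ 3)⁻¹ * ‖e‖ := by ring

/-! ### Consequences for the Biot–Savart law -/

/-- The singular potential of `biotSavartCLM` is the tree's `biotSavart`. [folklore] -/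
@[simp]
theorem singularPotential_biotSavartCLM (ω : ℝ³ → ℝ³) :
    singularPotential biotSavartCLM ω = biotSavart ω := rfl

/-- **The Biot–Savart velocity of a compactly supported Hölder vorticity is `C¹`**: for
`ω : ℝ³ → ℝ³` `γ`-Hölder (`0 < γ`) with compact support, `v = K₃ ∗ ω = biotSavart ω` is
continuously differentiable (Majda–Bertozzi Prop. 2.20 / (4.39), qualitative part;
Gilbarg–Trudinger §4.1 Lemma 4.2 through `contDiff_singularPotential`). [cite: MajdaBertozziCUP2002, §2.4.3 Prop. 2.20 and §4.1.3 (4.39)] -/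
theorem contDiff_biotSavart {γ C : ℝ≥0} (hγ : 0 < γ) {ω : ℝ³ → ℝ³} (hω : HolderWith C γ ω)
    (hωc : HasCompactSupport ω) : ContDiff ℝ 1 (biotSavart ω) := by
  obtain ⟨A, hK⟩ := exists_isC1SingularKernel_biotSavartCLM
  have h := contDiff_singularPotential hK hγ hω hωc
  rwa [singularPotential_biotSavartCLM] at h

/-- **The gradient of the Biot–Savart velocity** at `x ∈ B(x₀, ρ/2)` when `supp ω ⊆ B̄(x₀, ρ)`:
`∇v(x) = gradPotential biotSavartCLM x₀ ρ ω x`, i.e.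
`∇v(x) e = ∫ (∇K₃(x−y) e)(ω y − χ y • ω x) dy + ∫ (∂ₑχ)(y) • K₃(x−y) ω(x) dy` with the smooth
cutoff `χ = suppCutoff x₀ ρ` (Gilbarg–Trudinger (4.9); the cutoff form of Majda–Bertozzi
(4.49)). [cite: MajdaBertozziCUP2002, §4.2 (4.49)] -/
theorem hasFDerivAt_biotSavart {γ C : ℝ≥0} (hγ : 0 < γ) {ω : ℝ³ → ℝ³} (hω : HolderWith C γ ω)
    {x₀ : ℝ³} {ρ : ℝ} (hρ : 0 < ρ) (hsupp : tsupport ω ⊆ closedBall x₀ ρ) {x : ℝ³}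
    (hx : ‖x - x₀‖ < ρ / 2) :
    HasFDerivAt (biotSavart ω) (gradPotential biotSavartCLM x₀ ρ ω x) x := by
  obtain ⟨A, hK⟩ := exists_isC1SingularKernel_biotSavartCLM
  have h := hasFDerivAt_singularPotential hK hγ hω hρ hsupp hx
  rwa [singularPotential_biotSavartCLM] at h

end Literature.Analysis.FluidPDE
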